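import Summits.BirchSwinnertonDyer.BirchSwinnertonDyer.Theorems.DerivedKatoValuationDoorIntegralH1RankLeTwoOfAnalyticRankTwoStubRankLeSelmerCorank
import HarnessLib

set_option linter.dupNamespace false
set_option autoImplicit false

/-!
# `rank_{ℤ_p} H¹(ℤ[1/p], T_pW) ≤ corank_{ℤ_p} Sel_{p^∞}(W/ℚ)` OFF THE DOOR: `W(ℚ)[p] = 0` and `ε_p = 1` suffice
# (INPUTS desk, seat `bsd-inputs-honda-p1` g14; companion of the registered stub
# `stub_rankIntegralH1LeSelmerCorankAtDoor` of crux stmt-BirchSwinnertonDyer-23752; `--supports 23752`, closes nothing)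

The proof of the door stub (file `…StubRankLeSelmerCorank`) uses the door hypothesis
`5 ≤ p ∧ IsOrdinaryAt W p ∧ ρ̄_{W,p} onto` ONLY through `W(ℚ)[p] = 0` (`torsionBy_point_eq_bot_of_door`).  This file
records the same assembly with `W(ℚ)[p] = 0` as the hypothesis — no `5 ≤ p`, no ordinarity, no surjectivity — so the
`≤` half of the compact-versus-discrete Selmer rank dictionary ([PR93] Lemme 2.3.9, [Kato04] §14.1) is available at
`p = 2, 3`, at supersingular `p`, and under mere irreducibility of `ρ̄_{W,p}`; the `ε_p = 1` witness is supplied, for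
instance, by one rational point of infinite order (`exists_integral_hasLocPKummerLog_ne_zero_of_not_isOfFinAddOrder`,
LEAD dkd-p1, file `…CrisAtOfPoint`).  Route-independent imports.  UNCONDITIONAL; no item is closed; BSD is not proved
by any of this.

References: [PR93] = [cite: PerrinRiou1993AIF, Lemme 2.3.9 (p. 967)]; [Kato04] = [cite: Kato2004Asterisque, §13.8 (p. 228),
§14.1 (pp. 234–235)]; [Gr99] = [cite: Greenberg1999LNM, §1 (pp. 54–57)].
-/

noncomputable section

open scoped Classical AddSubgroup

namespace Summit.BirchSwinnertonDyer.BirchSwinnertonDyer.Theorems.DerivedKatoValuationDoor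

open Field
open Literature Literature.NumberTheory.GaloisRepresentations
open Literature.NumberTheory.EllipticCurves Literature.NumberTheory.EllipticCurves.Kato2004
open Literature.NumberTheory.EllipticCurves.Kato2004.EulerSystemValues
open WeierstrassCurve (galH1Primary selmerGroupPInfty)

variable (W : WeierstrassCurve ℚ) [W.IsElliptic] [W.IsGloballyMinimal] (p : ℕ) [Fact p.Prime]
  [ContinuousSMul ℤ_[p] (W.tateModule p)]

/-- **`rank_{ℤ_p} H¹(ℤ[1/p], T_pW) ≤ corank_{ℤ_p} Sel_{p^∞}(W/ℚ)` at EVERY prime `p` with `W(ℚ)[p] = 0`, under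
`ε_p = 1`** (some integral class with a Kummer localisation of non-zero logarithm).  Same assembly as the door stub:
uniform Selmer multiplier, `p`-saturated hull, the level subgroups `Ψ_e(A) ≤ Sel_{p^∞}[p^e]` of order
`≥ p^{(e−a−b)·r}` (`exists_addSubgroup_level`), and the counting lemma `le_zpCorank_of_forall_exists_addSubgroup`.
Unconditional. [cite: PerrinRiou1993AIF, Lemme 2.3.9 (p. 967)] [cite: Kato2004Asterisque, §14.1 (pp. 234–235)] -/
theorem rank_integralH1_le_selmerCorank_of_torsionBy_eq_bot
    (hK : AddSubgroup.torsionBy W.toAffine.Point (p : ℤ) = ⊥)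
    (hε : ∃ (x : H1 (tateRep W p) ⊤) (t : ℚ_[p]),
      x ∈ integralH1 (tateRep W p) p ⊤ ∧ t ≠ 0 ∧ HasLocPKummerLog W p x t) :
    Module.rank ℤ_[p] ↥(integralH1 (tateRep W p) p ⊤) ≤ (W.selmerCorank p : Cardinal) := by
  have hp : p.Prime := Fact.out
  -- uniform multiplier, saturated hull
  obtain ⟨M, hM0, hM⟩ := exists_uniform_nsmul_reduceH1Pk_mem_selmerGroup_of_exists_log_ne_zero W p hε
  obtain ⟨N, hAN, -, hsat, -, b, hb⟩ := exists_saturatedHull_integralH1 W p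
  -- `Sel_{p^∞}` is `p`-primary with finite `p`-torsion
  have hprim : ∀ x : ↥(selmerGroupPInfty W p), ∃ n : ℕ, p ^ n • x = 0 := fun x ↦ by
    obtain ⟨n, hn⟩ := WeierstrassCurve.exists_pow_smul_galH1Primary_eq_zero W (x : galH1Primary W p)
    exact ⟨n, Subtype.ext (by rw [AddSubgroupClass.coe_nsmul, hn, ZeroMemClass.coe_zero])⟩
  haveI := WeierstrassCurve.finite_torsionBy_selmerGroupPInfty W (p := p)
  haveI : Module.Finite ℤ_[p] ↥(integralH1 (tateRep W p) p ⊤) := module_finite_integralH1_top W p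
  -- the counting lemma, level by level
  have hle : Module.finrank ℤ_[p] ↥(integralH1 (tateRep W p) p ⊤) ≤ zpCorank ↥(selmerGroupPInfty W p) p := by
    refine le_zpCorank_of_forall_exists_addSubgroup p hprim
      (C := p ^ (((M : ℤ_[p]).valuation + b) * Module.finrank ℤ_[p] ↥(integralH1 (tateRep W p) p ⊤)))
      fun e ↦ ?_
    cases e with
    | zero =>
      refine ⟨⊥, fun x hx ↦ by rw [(AddSubgroup.mem_bot).mp hx, smul_zero], ?_⟩
      rw [zero_mul, pow_zero, AddSubgroup.card_bot, mul_one]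
      exact Nat.one_le_pow _ _ hp.pos
    | succ k => exact exists_addSubgroup_level W p hK hM0 hM hAN hsat hb k
  have hsc : W.selmerCorank p = zpCorank ↥(selmerGroupPInfty W p) p := rfl
  rw [← Module.finrank_eq_rank, hsc]
  exact_mod_cast hle

omit [W.IsGloballyMinimal] [ContinuousSMul ℤ_[p] (W.tateModule p)] in
/-- `ρ̄_{W,p}` irreducible ⇒ `W(ℚ)[p] = 0` (the tree's `SelmerSha.torsionBy_point_eq_bot` at `K = 1`, in the
`(p : ℤ)`-dialect). [cite: Mazur1977, Ch. III §5 (p. 157)] -/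
theorem torsionBy_point_eq_bot_of_hasIrreducibleModPGaloisRep (hirr : W.HasIrreducibleModPGaloisRep p) :
    AddSubgroup.torsionBy W.toAffine.Point (p : ℤ) = ⊥ := by
  have h := Summit.BirchSwinnertonDyer.Rank1Residual.GaloisImage.SelmerSha.torsionBy_point_eq_bot W p hirr 1
  simp only [pow_one] at h
  convert h using 2

/-- **The inequality under `ρ̄_{W,p}` irreducible**, any prime `p`, under `ε_p = 1`.  Unconditional.
[cite: PerrinRiou1993AIF, Lemme 2.3.9 (p. 967)] [cite: Kato2004Asterisque, §14.1 (pp. 234–235)] -/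
theorem rank_integralH1_le_selmerCorank_of_hasIrreducibleModPGaloisRep
    (hirr : W.HasIrreducibleModPGaloisRep p)
    (hε : ∃ (x : H1 (tateRep W p) ⊤) (t : ℚ_[p]),
      x ∈ integralH1 (tateRep W p) p ⊤ ∧ t ≠ 0 ∧ HasLocPKummerLog W p x t) :
    Module.rank ℤ_[p] ↥(integralH1 (tateRep W p) p ⊤) ≤ (W.selmerCorank p : Cardinal) :=
  rank_integralH1_le_selmerCorank_of_torsionBy_eq_bot W p
    (torsionBy_point_eq_bot_of_hasIrreducibleModPGaloisRep W p hirr) hε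

/-- **Finite-rank form**: under `W(ℚ)[p] = 0` and `ε_p = 1`,
`finrank_{ℤ_p} H¹(ℤ[1/p], T_pW) ≤ W.selmerCorank p` in `ℕ` (`H¹(ℤ[1/p], T_pW)` is finitely generated,
`module_finite_integralH1_top`).  Unconditional. [cite: PerrinRiou1993AIF, Lemme 2.3.9 (p. 967)] -/
theorem finrank_integralH1_le_selmerCorank_of_torsionBy_eq_bot
    (hK : AddSubgroup.torsionBy W.toAffine.Point (p : ℤ) = ⊥)
    (hε : ∃ (x : H1 (tateRep W p) ⊤) (t : ℚ_[p]),
      x ∈ integralH1 (tateRep W p) p ⊤ ∧ t ≠ 0 ∧ HasLocPKummerLog W p x t) :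
    Module.finrank ℤ_[p] ↥(integralH1 (tateRep W p) p ⊤) ≤ W.selmerCorank p := by
  haveI : Module.Finite ℤ_[p] ↥(integralH1 (tateRep W p) p ⊤) := module_finite_integralH1_top W p
  have h := rank_integralH1_le_selmerCorank_of_torsionBy_eq_bot W p hK hε
  rw [← Module.finrank_eq_rank] at h
  exact_mod_cast h

end Summit.BirchSwinnertonDyer.BirchSwinnertonDyer.Theorems.DerivedKatoValuationDoor

end
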